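import Mathlib
import Literature.MathematicalPhysics.QuantumFieldTheory.FinTorusAspectComparison
import Literature.MathematicalPhysics.QuantumFieldTheory.YangMillsOS
import HarnessLib

/-!
# Route `MagneticFluxCeiling`, crux `AspectOnePurity` (stmt-QuantumFields-25308): the registered RUNG `stub_strongCouplingPurity`

The BC3 birth skeleton of the crux (namespace `Summit.QuantumFields.YangMills.Theses.MagneticFluxCeilingBirthK2`, sha `dcbf0359…`) registers
`stub_strongCouplingPurity : StrongCouplingPurityP` (planner RUNG-PLAN-K2): for `SU(N)`, `N ≥ 2`, `r`, there is `β₀ > 0` such that for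
`0 < β ≤ β₀`: `∃ c > 0, ∃ L₀, ∀ L ≥ L₀, c · Z(L⁴)² ≤ Z(L³ × 2L)` (`Z = wilsonFinTorusPartition r.ρ β`).  PROOF: the strong-coupling cluster expansion
on the ANISOTROPIC boxes `L³ × 2L` and `L³ × L` compared along the `2 : 1` time covering (`Literature/…/FinTorusAspectComparison.lean`,
`abs_log_wilsonFinTorusPartition_double_sub_le`: `|ln Z(L³×2L) - 2 ln Z(L⁴)| ≤ 24·L⁴·e^{-(⌊(L-1)/2⌋+1)}` for `|β| ≤ 1/(4(N_r+1)·97²e²)` — the bulk free energy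
cancels EXACTLY, only clusters large enough to wrap the time circle survive), and the arithmetic `L⁴ e^{-(⌊(L-1)/2⌋+1)} ≤ 384`.  Witnesses:
`β₀ := 1/(4(N_r+1)·97²e²)`, `c := e^{-9216}`, `L₀ := 1`.  Route-independent imports (Literature only; the statement is spelled over
`wilsonFinTorusPartition`, pattern of `MagneticFluxCeilingAspectOnePurityStubSpectralGrowthFloor.lean`).

HONEST LABEL: the RUNG of ⟨25308⟩ at STRONG coupling only — where the aspect-one purity tends to `1`, the opposite extreme of the weak-coupling
toron regime the crux is about; `stub_thermalExcessBound` (all `β`) remains the crux's content; ⟨25308⟩, ⟨25307⟩ stay OPEN; no summit is proved;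
the Yang–Mills mass gap is NOT proved.
-/

noncomputable section

open MeasureTheory Filter Topology Function

namespace Summit.QuantumFields.YangMills.Theorems.MagneticFluxCeiling

open Literature.MathematicalPhysics.QuantumFieldTheory

/-- The registered stub's statement, letter for letter (birth skeleton of stmt-QuantumFields-25308, stub
`stub_strongCouplingPurity : StrongCouplingPurityP`, THE RUNG): aspect-one purity at strong coupling `0 < β ≤ β₀(N, r)`:
`c · Z(L⁴)² ≤ Z(L³ × 2L)` for `L ≥ L₀`. [problem-side] -/
def StrongCouplingPurityP : Prop :=
  ∀ N : ℕ, 2 ≤ N → ∀ r : Literature.MathematicalPhysics.QuantumFieldTheory.LatticeRep (Matrix.specialUnitaryGroup (Fin N) ℂ), ∃ β₀ : ℝ, 0 < β₀ ∧ ∀ β : ℝ, 0 < β → β ≤ β₀ → ∃ c : ℝ, 0 < c ∧ ∃ L₀ : ℕ, ∀ L : ℕ, L₀ ≤ L → c * (Literature.MathematicalPhysics.QuantumFieldTheory.wilsonFinTorusPartition r.ρ β L L L L) ^ 2 ≤ Literature.MathematicalPhysics.QuantumFieldTheory.wilsonFinTorusPartition r.ρ β L L L (2 * L)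

/-- `L⁴ e^{-((L-1)/2 + 1)} ≤ 384` for every `L` (from `(L/2)⁴/4! ≤ e^{L/2}` and `⌊(L-1)/2⌋ + 1 ≥ L/2`). [problem-side] -/
theorem pow_four_mul_exp_neg_half_le (L : ℕ) : (L : ℝ) ^ 4 * Real.exp (-((((L - 1) / 2 : ℕ) : ℝ) + 1)) ≤ 384 := by
  have hL : (0 : ℝ) ≤ (L : ℝ) / 2 := by positivity
  have hq := Real.pow_div_factorial_le_exp ((L : ℝ) / 2) hL 4
  have h4 : (Nat.factorial 4 : ℝ) = 24 := by norm_num [Nat.factorial]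
  rw [h4] at hq
  have hdiv : (L : ℝ) / 2 ≤ (((L - 1) / 2 : ℕ) : ℝ) + 1 := by
    have h1 : L ≤ 2 * ((L - 1) / 2) + 2 := by omega
    have h2 : (L : ℝ) ≤ 2 * (((L - 1) / 2 : ℕ) : ℝ) + 2 := by exact_mod_cast h1
    linarith
  have hexp : Real.exp (-((((L - 1) / 2 : ℕ) : ℝ) + 1)) ≤ Real.exp (-((L : ℝ) / 2)) :=
    Real.exp_le_exp.2 (by linarith)
  have hpos : 0 < Real.exp ((L : ℝ) / 2) := Real.exp_pos _
  calc (L : ℝ) ^ 4 * Real.exp (-((((L - 1) / 2 : ℕ) : ℝ) + 1))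
      ≤ (L : ℝ) ^ 4 * Real.exp (-((L : ℝ) / 2)) := mul_le_mul_of_nonneg_left hexp (by positivity)
    _ = ((L : ℝ) / 2) ^ 4 / 24 * (384 / Real.exp ((L : ℝ) / 2)) := by rw [Real.exp_neg]; ring
    _ ≤ Real.exp ((L : ℝ) / 2) * (384 / Real.exp ((L : ℝ) / 2)) := mul_le_mul_of_nonneg_right hq (by positivity)
    _ = 384 := by field_simp

/-- **THE RUNG `stub_strongCouplingPurity` BY NAME AND SIGNATURE**: at strong coupling `0 < β ≤ β₀ := 1/(4(N_r+1)·97²e²)` (`N_r` = the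
dimension of the lattice representation `r`), for EVERY `L ≥ 1`: `e^{-9216} · Z(L⁴)² ≤ Z(L³ × 2L)` — from the aspect comparison along the
`2 : 1` time covering `|ln Z(L³×2L) - 2 ln Z(L⁴)| ≤ 24·L⁴·e^{-(⌊(L-1)/2⌋+1)} ≤ 24·384` (strong-coupling cluster expansion on the anisotropic box:
the bulk free energy cancels exactly; only wrapping clusters survive).  Witnesses `β₀`, `c := e^{-9216}`, `L₀ := 1`.  HONEST LABEL: the rung
of ⟨25308⟩ at STRONG coupling only (purity `→ 1` there, the opposite of the weak-coupling toron regime); `stub_thermalExcessBound` (all `β`)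
remains the crux's content; no summit is proved; the Yang–Mills mass gap is NOT proved. [problem-side] -/
theorem stub_strongCouplingPurity : StrongCouplingPurityP := by
  intro N hN r
  refine ⟨1 / (4 * ((r.N : ℝ) + 1) * ((97 : ℝ) ^ 2 * Real.exp 2)), by positivity, fun β hβ hβ₀ => ?_⟩
  refine ⟨Real.exp (-9216), Real.exp_pos _, 1, fun L hL => ?_⟩
  haveI : NeZero L := ⟨by omega⟩
  have hβabs : |β| ≤ 1 / (4 * ((r.N : ℝ) + 1) * ((97 : ℝ) ^ 2 * Real.exp 2)) := by
    rw [abs_of_pos hβ]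
    exact hβ₀
  have hR : 2 * ((L - 1) / 2) < L := by omega
  have h := abs_log_wilsonFinTorusPartition_double_sub_le (Ls := L) (n := L) r.ρ r.continuous hβabs (by omega) hR
  have hZ₁ := wilsonFinTorusPartition_pos (ρ := r.ρ) r.continuous β L L L L
  have hZ₂ := wilsonFinTorusPartition_pos (ρ := r.ρ) r.continuous β L L L (L + L)
  rw [two_mul]
  -- `|log Z₂ - 2 log Z₁| ≤ 24 L⁴ e^{-(R+1)} ≤ 9216`
  have hB : |Real.log (wilsonFinTorusPartition r.ρ β L L L (L + L)) -
      2 * Real.log (wilsonFinTorusPartition r.ρ β L L L L)| ≤ 9216 := by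
    refine h.trans ?_
    have h384 := pow_four_mul_exp_neg_half_le L
    have : 24 * ((L : ℝ) ^ 3 * L) * Real.exp (-(((((L - 1) / 2 : ℕ)) : ℝ) + 1)) =
        24 * ((L : ℝ) ^ 4 * Real.exp (-(((((L - 1) / 2 : ℕ)) : ℝ) + 1))) := by ring
    rw [this]
    linarith
  have hlow := (abs_le.1 hB).1
  -- exponentiate
  have hkey : Real.log (Real.exp (-9216) * wilsonFinTorusPartition r.ρ β L L L L ^ 2) ≤
      Real.log (wilsonFinTorusPartition r.ρ β L L L (L + L)) := by
    rw [Real.log_mul (Real.exp_pos _).ne' (pow_pos hZ₁ 2).ne', Real.log_exp, Real.log_pow]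
    push_cast
    linarith
  exact (Real.log_le_log_iff (mul_pos (Real.exp_pos _) (pow_pos hZ₁ 2)) hZ₂).1 hkey

end Summit.QuantumFields.YangMills.Theorems.MagneticFluxCeiling

end
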